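import Literature.Computability.AlgebraicComplexity.LogEnclosuresSq
import Literature.Computability.AlgebraicComplexity.LogLinearCertificate
import HarnessLib

/-!
# The standard table of prime logarithms for the log-linear certificate checker

Topic `Literature/Computability/AlgebraicComplexity`.  Assembles the proved enclosures
`log<q>_enclosure` (`LogEnclosures.lean`, `LogEnclosuresSq.lean`) of `2^64 ln q`, `q` prime `≤ 47`,
into `stdLogTable : LogTable` (`LogLinearCertificate.lean`) and PROVES `stdLogTable_sound`, the
hypothesis of the checker's soundness theorem `LinCert.le_of_check`.  No named facts.

## References

* V. Vassilevska Williams, Y. Xu, Z. Xu, R. Zhou, SODA 2024, arXiv:2307.07970, §8.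
  [VassilevskaWilliamsXuXuZhou2024]
-/

namespace Literature.Computability.AlgebraicComplexity

section Table

/-- **The standard table of prime logarithms** at scale `2^64`: primes `2 … 47` with the proved
enclosures `log{q}_enclosure`. [folklore] -/
def stdLogTable : LogTable where
  L := 64
  qs := [2, 3, 5, 7, 11, 13, 17, 19, 23, 29, 31, 37, 41, 43, 47]
  lo := [12786308645202655659, 20265819725292939638, 29688889273197213359, 35895706510057370946, 44233360412869490419, 47314964359118725070, 52263561464023824861, 54315312289337937469, 57839659345841619230, 62115644396229875624, 63345883113530801695, 66609678605721511663, 68503313513771021680, 69381895944205902533, 71022687454752066348]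
  hi := [12786308645202655660, 20265819725292939639, 29688889273197213360, 35895706510057370956, 44233360412869490426, 47314964359118725075, 52263561464023824865, 54315312289337937473, 57839659345841619237, 62115644396229875632, 63345883113530801700, 66609678605721511669, 68503313513771021689, 69381895944205902544, 71022687454752066356]

/-- **The standard table is sound.** [folklore] -/
theorem stdLogTable_sound : stdLogTable.Sound := by
  simp only [LogTable.Sound, stdLogTable, LogTableSound, Nat.cast_ofNat, Int.cast_ofNat]
  exact ⟨by norm_num, log2_enclosure.1, log2_enclosure.2, by norm_num, log3_enclosure.1, log3_enclosure.2,
    by norm_num, log5_enclosure.1, log5_enclosure.2, by norm_num, log7_enclosure.1, log7_enclosure.2,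
    by norm_num, log11_enclosure.1, log11_enclosure.2, by norm_num, log13_enclosure.1, log13_enclosure.2,
    by norm_num, log17_enclosure.1, log17_enclosure.2, by norm_num, log19_enclosure.1, log19_enclosure.2,
    by norm_num, log23_enclosure.1, log23_enclosure.2, by norm_num, log29_enclosure.1, log29_enclosure.2,
    by norm_num, log31_enclosure.1, log31_enclosure.2, by norm_num, log37_enclosure.1, log37_enclosure.2,
    by norm_num, log41_enclosure.1, log41_enclosure.2, by norm_num, log43_enclosure.1, log43_enclosure.2,
    by norm_num, log47_enclosure.1, log47_enclosure.2, trivial⟩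

end Table

end Literature.Computability.AlgebraicComplexity
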